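/-
Copyright (c) 2026 the pub-hodgecm-mathlib formalisation cell (harness21).  Prover seat hodgecm-mathlib-LH4-p07 (g9), req620 Track A «(D-RAM) FOUR-FRAME» squad
(STAGE-1b, row-(2) lineage; dealer LH4-plan (g13) WORD #94 (1) ∕ #97: the RamM lane of the level law — the closing ℚ-identity), 2026-09-04.
-/
import Summits.HodgeConjecture.HodgeConjecture.Theorems.F0P3cDyRamLevelsCensusLawArithRamK       -- ★ p859957 (this seat): `law_arith`, `sum_pow_add_eq_mul_sum`
import Summits.HodgeConjecture.HodgeConjecture.Theorems.F0P3cDyRamLevelsLawExponentsRamM          -- ★ p860594 (this seat): `exponents_std_ramM`, `exponents_flip_ramM` (regime A)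
import Summits.HodgeConjecture.HodgeConjecture.Theorems.F0P3cDyRamLevelsLawExponentsRamMRegB      -- ★ p860818 (this seat): the regime-B rows
import Summits.HodgeConjecture.HodgeConjecture.Theorems.F0P3cDyRamToricCensusSumRamMCutoff        -- ★ (LH4-p04 (g7)): `filter_band_eq_Ioc_ramM`
import HarnessLib

/-!
# Crux `H413`, line LH4 «(D-RAM) FOUR-FRAME» — STAGE-1b, row (2): (LAW-RamM) «THE TWO-LITERAL LEVEL LAW ON TYPE RamM, AS ONE ℚ-IDENTITY PER LANE»
# `(q − 1)·q^{ks}·W_RamM(m − a, jλ − a, C) = 2q^m(q^{(jλ−g)∕2+1} − q^T)`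

Cell `hodgecm-mathlib` (D-0151), FLOOR 0, crux item H413 = `stmt-HodgeConjecture-24833`, route of record `HCCMUnconditional`; squad F0∕P3c∕LH4; lane
`--supports stmt-HodgeConjecture-24833 --as helper` (count-neutral; pays NO tier-0 row).  THEOREMS ONLY (no `def`, no instance, no notation, no `sorry`, default heartbeats).
OWNER'S ORGAN №24 — the `hlaw` input of ★ p860127 `levels_bottom_arith` for the RamM level socket `levelsCensusC`, packaged ONCE per parity lane so the socket closes each
lane with a single `exact`: `W` is the value of ★ (LH4-p06) `levelOrderCounts_ramM_weld_cut_of_frame[_flip]` (= ★ p860773's RHS at the scaled tokens `(m − a, jλ − a)` and the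
cutoff `C = m + jλ − b`), the band is summed by ★ `filter_band_eq_Ioc_ramM` + ★ `sum_pow_add_eq_mul_sum`, the exponents come from ★ p860594 (regime A: `m + s0 ≤ jλ`, parity
`m + s0 ≡ jλ`) or ★ p860818 (regime B: `jλ + 1 = m + s0`), and ★ `law_arith` closes.  §1 `law_ramM_std` (lane `a` even), §2 `law_ramM_flip` (lane `a` odd).
HONEST LABEL.  Count-neutral arithmetic; no lattice, no place; `HC_CM` is proved only modulo the 7 printed citations (2 remaining named inputs: hLiu418 =
`stmt-HodgeConjecture-24832`, h413 = `stmt-HodgeConjecture-24833`) until rung 0 closes.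

## References
* [Rogawski1990] J. D. Rogawski, *Automorphic Representations of Unitary Groups in Three Variables*, Ann. of Math. Stud. 123 (1990): §4.9 pp. 54–56 (orbital-integral bookkeeping).
-/

open Finset

namespace Summit.HodgeConjecture.HodgeConjecture.Cruxes.H413.F0P3cDyRamLevelsLawRamM

open Summit.HodgeConjecture.HodgeConjecture.Cruxes.H413.F0P3cDyRamLevelsCensusLawArithRamK (law_arith sum_pow_add_eq_mul_sum)
open Summit.HodgeConjecture.HodgeConjecture.Cruxes.H413.F0P3cDyRamLevelsLawExponentsRamM (exponents_std_ramM exponents_flip_ramM)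
open Summit.HodgeConjecture.HodgeConjecture.Cruxes.H413.F0P3cDyRamLevelsLawExponentsRamMRegB (exponents_std_ramM_regB exponents_flip_ramM_regB)
open Summit.HodgeConjecture.HodgeConjecture.Cruxes.H413.F0P3cDyRamToricCensusSumRamMCutoff (filter_band_eq_Ioc_ramM)

/-- **§1 THE RamM LEVEL LAW, STANDARD LANE (`a` even).**  With the dictionary `g + s0 = d`, the conductor class `jλ ≡ g`, the regime letter of ★ (C) (`hreg`), the piece
letters `(ks, T)` of ★ p860496 and the cutoff `C = m + jλ − b`: `(x − 1)·x^{ks}·W = 2x^m(x^{n+1} − x^T)` for the standard-lane cut value `W` at `(m − a, jλ − a, C)`,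
`n + 1 = (jλ − g)∕2 + 1`. [cite: Rogawski1990, §4.9 pp. 54–56] -/
theorem law_ramM_std (x : ℚ) (hx : x ≠ 1) {a b d g s0 ks T m jl n C : ℕ} (hgs : g + s0 = d) (hjlpar : jl % 2 = g % 2)
    (hreg : (m + s0 ≤ jl ∧ (m + s0) % 2 = jl % 2) ∨ jl + 1 = m + s0) (hmjl : m ≤ jl)
    (hab1 : d + 2 * a ≤ b + 1) (hbm : b ≤ m) (hg : 1 ≤ g) (hs0 : 1 ≤ s0) (hC : C = m + jl - b) (hn : (jl - g) / 2 + 1 = n + 1) (ha2 : a % 2 = 0)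
    (hks : 2 * ks + 2 * ((d + a % 2) / 2) = a + a % 2 + (b + b % 2)) (hT : a % 2 = 0 → T + a = ks + (d - d % 2)) (hdjl : d + a ≤ jl) (hjlbig : b + 2 * d ≤ jl) :
    (x - 1) * x ^ ks * (x ^ (m - a) * (2 * ∑ i ∈ range ((jl - a - g) / 2 + 1), x ^ i - 2 * ∑ i ∈ range (g + s0 - (g + s0) % 2), x ^ i) -
      2 * ∑ a' ∈ (range (jl - a + 2)).filter (fun a' => a' ≤ m - a ∧ C + (m - a) < jl - a + 2 * a' ∧
        2 * (m - a) + 2 * g + s0 < jl - a + 2 * a' + 2 ∧ 2 * a' + (g + s0) ≤ 2 * (m - a) + 1), x ^ (a' + (jl - a + s0) / 2)) =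
      2 * x ^ m * (x ^ (n + 1) - x ^ T) := by
  rw [filter_band_eq_Ioc_ramM hg hs0 (by omega : m - a ≤ jl - a) (by omega : jl - a ≤ C) (by clear hn hks hT; omega : m - a + 2 * g + s0 ≤ C + 2),
    sum_pow_add_eq_mul_sum, ← mul_assoc (2 : ℚ)]
  rcases hreg with ⟨-, hpar⟩ | hregB
  · have hmpar : m % 2 = d % 2 := by clear hn hks hT hC hab1 hdjl hbm hx hjlbig; omega
    obtain ⟨eLU, e1, e2, e3⟩ := exponents_std_ramM hgs hjlpar hmpar hmjl hab1 hbm hg hs0 hC hn ha2 hks hT hdjl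
    exact law_arith _ hx eLU e1 e2 e3
  · obtain ⟨eLU, e1, e2, e3⟩ := exponents_std_ramM_regB hgs hjlpar hregB hmjl hab1 hbm hg hs0 hC hn ha2 hks hT hdjl
    exact law_arith _ hx eLU e1 e2 e3

/-- **§2 THE RamM LEVEL LAW, FLIPPED LANE (`a` odd)**: the same identity for the flipped cut value (`2[(jλ−a+1−g)∕2 + (g+s0)%2]_x − 2[(g+s0)−1+(g+s0)%2]_x` in the top bracket).
[cite: Rogawski1990, §4.9 pp. 54–56] -/
theorem law_ramM_flip (x : ℚ) (hx : x ≠ 1) {a b d g s0 ks T m jl n C : ℕ} (hgs : g + s0 = d) (hjlpar : jl % 2 = g % 2)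
    (hreg : (m + s0 ≤ jl ∧ (m + s0) % 2 = jl % 2) ∨ jl + 1 = m + s0) (hmjl : m ≤ jl)
    (hab1 : d + 2 * a ≤ b + 1) (hbm : b ≤ m) (hg : 1 ≤ g) (hs0 : 1 ≤ s0) (hC : C = m + jl - b) (hn : (jl - g) / 2 + 1 = n + 1) (ha2 : a % 2 = 1)
    (hks : 2 * ks + 2 * ((d + a % 2) / 2) = a + a % 2 + (b + b % 2)) (hT : a % 2 = 1 → T + a + 1 = ks + (d - d % 2) + 2 * (d % 2)) (hdjl : d + a ≤ jl) (hjlbig : b + 2 * d ≤ jl) :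
    (x - 1) * x ^ ks * (x ^ (m - a) * (2 * ∑ i ∈ range ((jl - a + 1 - g) / 2 + (g + s0) % 2), x ^ i - 2 * ∑ i ∈ range (g + s0 - 1 + (g + s0) % 2), x ^ i) -
      2 * ∑ a' ∈ (range (jl - a + 2)).filter (fun a' => a' ≤ m - a ∧ C + (m - a) < jl - a + 2 * a' ∧
        2 * (m - a) + 2 * g + s0 < jl - a + 2 * a' + 2 ∧ 2 * a' + (g + s0) ≤ 2 * (m - a) + 1), x ^ (a' + (jl - a + s0) / 2)) =
      2 * x ^ m * (x ^ (n + 1) - x ^ T) := by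
  rw [filter_band_eq_Ioc_ramM hg hs0 (by omega : m - a ≤ jl - a) (by omega : jl - a ≤ C) (by clear hn hks hT; omega : m - a + 2 * g + s0 ≤ C + 2),
    sum_pow_add_eq_mul_sum, ← mul_assoc (2 : ℚ)]
  rcases hreg with ⟨-, hpar⟩ | hregB
  · have hmpar : m % 2 = d % 2 := by clear hn hks hT hC hab1 hdjl hbm hx hjlbig; omega
    obtain ⟨eLU, e1, e2, e3⟩ := exponents_flip_ramM hgs hjlpar hmpar hmjl hab1 hbm hg hs0 hC hn ha2 hks hT hdjl
    exact law_arith _ hx eLU e1 e2 e3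
  · obtain ⟨eLU, e1, e2, e3⟩ := exponents_flip_ramM_regB hgs hjlpar hregB hmjl hab1 hbm hg hs0 hC hn ha2 hks hT hdjl
    exact law_arith _ hx eLU e1 e2 e3

end Summit.HodgeConjecture.HodgeConjecture.Cruxes.H413.F0P3cDyRamLevelsLawRamM
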